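import Summits.HubbardSuperconductivity.HubbardSuperconductivity.Theorems.AnisotropyChordTransferFibre3RateLemma
import Summits.HubbardSuperconductivity.HubbardSuperconductivity.Theorems.AnisotropyChordTransferFibre3LatticeEnergy
import Literature.Probability.LatticeModels.TorusHeatKernel1D

/-!
# Route `AnisotropyChord` / H0 rotor rung: PartN39 — three ingredients of the SHELL MAJORANT, PROVED

PORT PartN39 (`…Fibre3RateLemma`, theory seat `hubbard-h0-rotor-theory-1` g21, memo 21 §321(a)) types the four elementary
ingredients of the λ-half RATE lemma `ShellMajorant`.  This file proves the three torus-side ones, reading the dispersion on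
symmetric integer representatives (`epsT_eq_wInt`, toolkit `…Fibre3LatticeEnergy` of p1 g22):
* `firstShellValues_holds : FirstShellValues L` — `ε(±e₁) = ε(±e₂) = ε₁`, `ε(1,±1) = 2ε₁` (every `L ≥ 1`);
* `shellFactorFar_holds : ShellFactorFar L` — `8 ≤ L`, `k ∉ S₁ ∪ S₂ ∪ {0}` ⇒ some representative has `|m| ≥ 2`, so
  `ε(k) ≥ wInt 2 = 2(1 + cos θ)ε₁ ≥ (2 + √2)ε₁ ≥ 3.414 ε₁`;
* `jordanEpsLower_holds : JordanEpsLower L` — `1 − cos(θm) = 2 sin²(θm/2) ≥ (2/π²)θ²m²` for `|θm| ≤ π` (Jordan `sin x ≥ 2x/π`).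
Prover seat `hubbard-h0-rotor-p2` g0; helper for stmt-HubbardSuperconductivity-19089 (`--supports`, helper class).
WHAT THIS IS NOT: nothing here proves superconductivity in the Hubbard model; helper lemmas of ONE conditional reduction
(rung 19089, HOLE₂(.75) near-pair tail, RATE lemma).  Mathlib + tree imports only; no sorry, no axioms.
-/

set_option linter.dupNamespace false

noncomputable section

namespace Summit.HubbardSuperconductivity.HubbardSuperconductivity.Theorems.AnisotropyChord.Transfer.Fibre3

namespace RateLemma

open Real

variable (L : ℕ) [NeZero L]

omit [NeZero L] in
/-- `valMinAbs 1 = 1` for `L ≥ 2`. -/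
theorem valMinAbs_one (hL : 2 ≤ L) : ((1 : ZMod L)).valMinAbs = 1 := by
  have h : ((1 : ℕ) : ZMod L).valMinAbs = (1 : ℕ) := ZMod.valMinAbs_natCast_of_le_half (by omega)
  simpa using h

omit [NeZero L] in
/-- `wInt (valMinAbs (−1)) = ε₁` for `L ≥ 2`. -/
theorem wInt_valMinAbs_neg_one (hL : 2 ≤ L) : wInt L ((-1 : ZMod L)).valMinAbs = eps1 L := by
  rw [← wInt_natAbs, ZMod.natAbs_valMinAbs_neg, valMinAbs_one L hL]
  simp [wInt_one]

/-- ★ `FirstShellValues` holds (every `L ≥ 1`). -/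
theorem firstShellValues_holds : FirstShellValues L := by
  unfold FirstShellValues
  rcases Nat.lt_or_ge L 2 with hlt | hL
  · -- L = 1: everything vanishes
    have hL1 : L = 1 := by have := NeZero.ne L; omega
    subst hL1
    have h0 : ∀ k : Tor 1, epsT 1 k = 0 := by
      intro k; rw [Subsingleton.elim k 0]; exact epsT_zero 1
    have h1 : eps1 1 = 0 := by simp [eps1]
    simp [h0, h1]
  · rw [epsT_eq_wInt, epsT_eq_wInt, epsT_eq_wInt, epsT_eq_wInt]
    simp only [valMinAbs_one L hL, ZMod.valMinAbs_zero, wInt_zero, wInt_one, wInt_valMinAbs_neg_one L hL]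
    refine ⟨by ring, by ring, by ring, by ring⟩

/-- `√2 > 1.414`. -/
theorem sqrt_two_gt : (1.414 : ℝ) < Real.sqrt 2 := by
  rw [show (1.414 : ℝ) = Real.sqrt (1.414 ^ 2) by rw [Real.sqrt_sq (by norm_num)]]
  exact Real.sqrt_lt_sqrt (by norm_num) (by norm_num)

omit [NeZero L] in
/-- off the first two shells some representative is at least `2` in absolute value. -/
theorem two_le_abs_valMinAbs_of_not_mem (k : Tor L) (hk0 : k ≠ 0) (hkS : k ∉ firstShells L) :
    2 ≤ |k.1.valMinAbs| ∨ 2 ≤ |k.2.valMinAbs| := by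
  by_contra hcon
  push Not at hcon
  obtain ⟨h1, h2⟩ := hcon
  have hk : k = (((k.1.valMinAbs : ℤ) : ZMod L), ((k.2.valMinAbs : ℤ) : ZMod L)) := by
    ext <;> simp [ZMod.coe_valMinAbs]
  have hm1 : k.1.valMinAbs = -1 ∨ k.1.valMinAbs = 0 ∨ k.1.valMinAbs = 1 := by
    rcases abs_lt.1 h1 with ⟨a, b⟩; omega
  have hm2 : k.2.valMinAbs = -1 ∨ k.2.valMinAbs = 0 ∨ k.2.valMinAbs = 1 := by
    rcases abs_lt.1 h2 with ⟨a, b⟩; omega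
  rw [hk] at hk0 hkS
  rcases hm1 with h | h | h <;> rcases hm2 with h' | h' | h' <;>
    simp [firstShells, h, h'] at hk0 hkS

/-- ★ `ShellFactorFar` holds: `8 ≤ L`, `k ∉ S₁ ∪ S₂ ∪ {0}` ⇒ `3.414 ε₁ ≤ ε(k)`. -/
theorem shellFactorFar_holds : ShellFactorFar L := by
  intro hL k hk0 hkS
  have hL0 : 0 < L := by omega
  have hc := sqrt2_div_two_le_cos L hL
  have hs := sqrt_two_gt
  have he1 : 0 ≤ eps1 L := by
    unfold eps1; linarith [Real.cos_le_one (2 * Real.pi / L)]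
  have hw2 : wInt L ((2 : ℕ) : ℤ) = 2 * (1 + Real.cos (2 * Real.pi / L)) * eps1 L := by
    exact_mod_cast wInt_two L
  rw [epsT_eq_wInt]
  have hb1 := Literature.Probability.LatticeModels.two_mul_abs_valMinAbs_le k.1
  have hb2 := Literature.Probability.LatticeModels.two_mul_abs_valMinAbs_le k.2
  rcases two_le_abs_valMinAbs_of_not_mem L k hk0 hkS with h | h
  · have hm := wInt_mono L (s := 2) (r := k.1.valMinAbs) (by exact_mod_cast h) hb1 hL0
    have hn := wInt_nonneg L k.2.valMinAbs
    rw [hw2] at hm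
    nlinarith
  · have hm := wInt_mono L (s := 2) (r := k.2.valMinAbs) (by exact_mod_cast h) hb2 hL0
    have hn := wInt_nonneg L k.1.valMinAbs
    rw [hw2] at hm
    nlinarith

/-- JORDAN on representatives: `(2/π²)θ² m² ≤ wInt m` for `2|m| ≤ L` (`θ = 2π/L`). -/
theorem jordan_wInt (m : ℤ) (hm : 2 * |m| ≤ (L : ℤ)) :
    2 / Real.pi ^ 2 * (2 * Real.pi / L) ^ 2 * ((m : ℝ)) ^ 2 ≤ wInt L m := by
  have hL0 : (0 : ℝ) < L := by exact_mod_cast Nat.pos_of_ne_zero (NeZero.ne L)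
  rw [← wInt_natAbs]
  set R : ℕ := m.natAbs with hR
  have hRm : ((R : ℤ) : ℝ) ^ 2 = ((m : ℝ)) ^ 2 := by
    rw [hR, Int.natCast_natAbs, Int.cast_abs, sq_abs]
  have hR2 : 2 * (R : ℝ) ≤ L := by
    have : (2 : ℤ) * (R : ℤ) ≤ L := by rw [hR, Int.natCast_natAbs]; exact hm
    exact_mod_cast this
  unfold wInt
  -- 1 − cos(2πR/L) = 2 sin²(πR/L)
  set x : ℝ := Real.pi * (R : ℝ) / L with hx
  have hcos : 1 - Real.cos (2 * Real.pi * ((R : ℤ) : ℝ) / L) = 2 * Real.sin x ^ 2 := by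
    rw [show 2 * Real.pi * ((R : ℤ) : ℝ) / L = 2 * x by rw [hx, Int.cast_natCast]; ring, Real.cos_two_mul,
      Real.cos_sq']
    ring
  rw [hcos]
  have hx0 : 0 ≤ x := by rw [hx]; positivity
  have hx1 : x ≤ Real.pi / 2 := by
    rw [hx, div_le_div_iff₀ hL0 (by norm_num : (0:ℝ) < 2)]
    nlinarith [Real.pi_pos]
  have hj := Real.mul_le_sin hx0 hx1
  have hj0 : 0 ≤ 2 / Real.pi * x := by positivity
  have hsq : (2 / Real.pi * x) ^ 2 ≤ Real.sin x ^ 2 := pow_le_pow_left₀ hj0 hj 2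
  have hpi : Real.pi ≠ 0 := Real.pi_ne_zero
  have e : 2 / Real.pi ^ 2 * (2 * Real.pi / L) ^ 2 * ((m : ℝ)) ^ 2 = 2 * (2 / Real.pi * x) ^ 2 := by
    rw [← hRm, hx]; push_cast; field_simp
  rw [e]
  linarith

/-- ★ `JordanEpsLower` holds. -/
theorem jordanEpsLower_holds : JordanEpsLower L := by
  intro k
  rw [epsT_eq_wInt]
  have h1 := jordan_wInt L k.1.valMinAbs (Literature.Probability.LatticeModels.two_mul_abs_valMinAbs_le k.1)
  have h2 := jordan_wInt L k.2.valMinAbs (Literature.Probability.LatticeModels.two_mul_abs_valMinAbs_le k.2)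
  have e : 2 / Real.pi ^ 2 * (2 * Real.pi / L) ^ 2 *
      ((((k.1.valMinAbs : ℤ) : ℝ)) ^ 2 + (((k.2.valMinAbs : ℤ) : ℝ)) ^ 2)
      = 2 / Real.pi ^ 2 * (2 * Real.pi / L) ^ 2 * (((k.1.valMinAbs : ℤ) : ℝ)) ^ 2
        + 2 / Real.pi ^ 2 * (2 * Real.pi / L) ^ 2 * (((k.2.valMinAbs : ℤ) : ℝ)) ^ 2 := by ring
  rw [e]
  exact add_le_add h1 h2

end RateLemma

end Summit.HubbardSuperconductivity.HubbardSuperconductivity.Theorems.AnisotropyChord.Transfer.Fibre3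

end
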